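import Mathlib
import Literature.NumberTheory.Irrationality.BrownZudilin2022.GeneralFamily
import HarnessLib

/-!
# ζ(5) search — BARRIER (i): Brown–Zudilin's direction cone, the 28 forms, `δ₂₈`, and the `S₇` saving `Φ`

HONEST FRAMING (cell `pub-zeta5`): systematic search; no irrationality claim unless kernel-certified. Everything here is the
MODEL — closed-form rates under Brown–Zudilin's own denominator accounting ((28) is an «experimental observation» of
[BZ22] = arXiv:2210.03391, p. 20; (29)–(30) rides on it); nothing is a theorem about `ζ(5)`; every `γ` the cell has
computed is `< 1` (no irrationality content); records in print UNMOVED. A «barrier» is a statement about a METHOD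
CLASS (BZ's 8-fold cellular box with lcm-type denominator laws), CONDITIONAL on NAMED accounting hypotheses — not a
theorem that `ζ(5)`-approximations cannot exist. Sources: census kernel `census_bz_gamma.py` (sha256 8972266e…) as
transcribed in the cell's `BARRIER-FORMULAS.md` (c7e5c80b…); coordinator's REFINED STRUCTURE TARGET 2026-08-23,
clause (i) «formalise γ(direction)»; cell file `BARRIER-PLAN.md` §1 (theory seat cert-2 g16).

This file (1/5): REAL directions `a : Fin 8 → ℝ` (index `i` ↦ `a_{i+1}`).
* `sParam`, `aOfS` — BZ §10 symmetric parameters `s₀..s₇` and the forward map (K `s_from_a`); `BZBox` — the CLOSED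
  positive box `0 ≤ sⱼ ≤ s₀`, apex removed; `BZCone` — the box together with the non-voidness margin `s₀ ≤ Σ sⱼ`
  (on the closed box BZ's double sum (17) for `Q(a·n)` is empty iff `s₀ > Σ sⱼ` — census status `no-zeta5` —
  checked against K's `q17_empty` on 50 000 box points; = census `in_polytope` / `CasoratianValuation.InPolytope`
  shape in the dual coordinates `b = (2s₀; s₀ − sⱼ)`, `mem_BZCone_iff_dual`); `BZCone_smul`.
* `h28` — the 28 linear forms (26) (= `BrownZudilin2022.hList` on integer vectors, `h28_realDir`); `FIdx` — `F` of
  (27), 0-based; `sum_FIdx_h28` — `Σ_{i∈F} h_i = 2s₀ + 4Σsⱼ` (`S₇`-invariant); `h28_aOfS` — the forms as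
  `s_i + s_j` / `s₀ − s_j`; `h28_nonneg_of_BZBox`.
* `delta28 a` — **CLOSED FORM** of the (28)-exponent `m₁+⋯+m₅`: the maximum over 5-element index sets of `Σ h_i`;
  `delta28_smul` (degree 1), `delta28_le_threshold` (LP certificate), `le_delta28`.
* `permAct` (`S₇` permuting `s₁..s₇`), `Admissible`, `savingTerm`, `savingN a u = N_a(u)` (BZ (29) at `u = n/p`;
  `savingN_nonneg`, `savingN_smul`), `admissible_of_BZBox` (every `σ` admissible on the box), and
  `phi30 a := ∫_{(0,∞)} N_a(u) u⁻² du` — **CLOSED FORM** of the (29)–(30) saving rate (the PNT limit of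
  `(1/n) log Φ_n`; equals K's `∫₀¹ N_a ψ′` for integer `a` by 1-periodicity — that equality is not proved here);
  `phi30_smul` — degree 1 for EVERY real `t > 0` (substitution), so `γ` (file `ConeGammaRates`) is a function on the
  real direction simplex.
-/

noncomputable section

open Finset MeasureTheory Set Filter
open scoped Topology Pointwise

namespace Summit.KontsevichZagierPeriods.Zeta5Search.Barrier.ConeGamma

open Literature.NumberTheory.Irrationality.BrownZudilin2022 (hList hForm)

/-- A real direction of Brown–Zudilin's 8-parameter family (`a i` is `a_{i+1}`). -/
abbrev Dir := Fin 8 → ℝ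

/-- The real direction of an integer parameter vector. -/
def realDir (a : Fin 8 → ℤ) : Dir := fun i => (a i : ℝ)

/-! ### Symmetric parameters (BZ §10) and the box cone -/

/-- BZ §10 «inverse transformation»: `s₀ = ½(a₂+a₃+a₄), s₁ = a₁+½(a₂−a₃−a₄), s₂ = ½(a₃+a₄−a₂), s₃ = ½(a₂+a₃−a₄),
s₄ = a₅+½(a₄−a₂−a₃), s₅ = a₈+½(a₄−a₂−a₃), s₆ = a₆−a₈+½(a₂+a₃−a₄), s₇ = a₇+a₈−a₆+½(a₄−a₂−a₃)` (K `s_from_a`). -/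
def sParam (a : Dir) : Fin 8 → ℝ :=
  ![(a 1 + a 2 + a 3) / 2, a 0 + (a 1 - a 2 - a 3) / 2, (a 2 + a 3 - a 1) / 2, (a 1 + a 2 - a 3) / 2,
    a 4 + (a 3 - a 1 - a 2) / 2, a 7 + (a 3 - a 1 - a 2) / 2, a 5 - a 7 + (a 1 + a 2 - a 3) / 2,
    a 6 + a 7 - a 5 + (a 3 - a 1 - a 2) / 2]

/-- BZ §10 forward map: `a₁ = s₁+s₂, a₂ = s₀−s₂, a₃ = s₂+s₃, a₄ = s₀−s₃, a₅ = s₃+s₄, a₆ = s₅+s₆, a₇ = s₆+s₇, a₈ = s₃+s₅`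
(lane `main.py` `a_from_s2`). -/
def aOfS (s : Fin 8 → ℝ) : Dir :=
  ![s 1 + s 2, s 0 - s 2, s 2 + s 3, s 0 - s 3, s 3 + s 4, s 5 + s 6, s 6 + s 7, s 3 + s 5]

/-- `a ↦ s ↦ a` is the identity. -/
theorem aOfS_sParam (a : Dir) : aOfS (sParam a) = a := by
  ext i; fin_cases i <;> simp [aOfS, sParam] <;> ring

/-- `s ↦ a ↦ s` is the identity. -/
theorem sParam_aOfS (s : Fin 8 → ℝ) : sParam (aOfS s) = s := by
  ext i; fin_cases i <;> simp [aOfS, sParam] <;> ring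

/-- `s` is linear: `s(t·a) = t·s(a)`. -/
theorem sParam_smul (t : ℝ) (a : Dir) : sParam (t • a) = t • sParam a := by
  ext i; fin_cases i <;> simp [sParam, smul_eq_mul] <;> ring

/-- `aOfS` is linear. -/
theorem aOfS_smul (t : ℝ) (s : Fin 8 → ℝ) : aOfS (t • s) = t • aOfS s := by
  ext i; fin_cases i <;> simp [aOfS, smul_eq_mul] <;> ring

/-- The CLOSED positive box with the apex removed: `0 < s₀` and `0 ≤ sⱼ ≤ s₀` for `j = 1..7` (closure of the lane's
open box `0 < sⱼ < s₀`; the parity condition `sⱼ ≡ s₀ (mod 1)` of integer classes is irrelevant for directions). -/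
def BZBox (a : Dir) : Prop :=
  0 < sParam a 0 ∧ ∀ j : Fin 7, 0 ≤ sParam a j.succ ∧ sParam a j.succ ≤ sParam a 0

/-- **The BZ direction cone** of the barrier statement: the closed positive box together with the non-voidness
margin `s₀ ≤ s₁ + ⋯ + s₇` (on the closed box, BZ's double sum (17) for `Q(a·n)` has a non-empty range iff this
holds; census status `no-zeta5` otherwise). In the dual coordinates `b₀ = 2s₀`, `bⱼ = s₀ − sⱼ` this is exactly
`0 ≤ 2bⱼ ≤ b₀ (j = 1..7) ∧ Σⱼ bⱼ ≤ 3b₀` (census `in_polytope`, tree `CasoratianValuation.InPolytope`), see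
`mem_BZCone_iff_dual`. -/
def BZCone : Set Dir :=
  {a | BZBox a ∧ sParam a 0 ≤ ∑ j : Fin 7, sParam a j.succ}

/-- The dual (well-poised) reading of the cone: with `b₀ = 2s₀`, `bⱼ = s₀ − sⱼ`,
`a ∈ BZCone ↔ 0 < b₀ ∧ (∀ j, 0 ≤ 2bⱼ ≤ b₀) ∧ Σⱼ bⱼ ≤ 3b₀`. -/
theorem mem_BZCone_iff_dual (a : Dir) :
    a ∈ BZCone ↔
      0 < 2 * sParam a 0 ∧ (∀ j : Fin 7, 0 ≤ 2 * (sParam a 0 - sParam a j.succ) ∧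
        2 * (sParam a 0 - sParam a j.succ) ≤ 2 * sParam a 0) ∧
        ∑ j : Fin 7, (sParam a 0 - sParam a j.succ) ≤ 3 * (2 * sParam a 0) := by
  simp only [BZCone, BZBox, Set.mem_setOf_eq, Finset.sum_sub_distrib, Finset.sum_const, Finset.card_univ,
    Fintype.card_fin, nsmul_eq_mul]
  constructor
  · rintro ⟨⟨h0, hj⟩, hsum⟩
    refine ⟨by linarith, fun j => ⟨by linarith [(hj j).2], by linarith [(hj j).1]⟩, by push_cast; linarith⟩
  · rintro ⟨h0, hj, hsum⟩
    refine ⟨⟨by linarith, fun j => ⟨by linarith [(hj j).2], by linarith [(hj j).1]⟩⟩, by push_cast at hsum; linarith⟩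

/-- The cone is a cone: invariant under positive dilations. -/
theorem BZCone_smul {t : ℝ} (ht : 0 < t) {a : Dir} (ha : a ∈ BZCone) : t • a ∈ BZCone := by
  obtain ⟨⟨h0, hj⟩, hsum⟩ := ha
  refine ⟨⟨?_, fun j => ⟨?_, ?_⟩⟩, ?_⟩
  · simpa [sParam_smul] using mul_pos ht h0
  · simpa [sParam_smul] using mul_nonneg ht.le (hj j).1
  · simpa [sParam_smul] using mul_le_mul_of_nonneg_left (hj j).2 ht.le
  · simp only [sParam_smul, Pi.smul_apply, smul_eq_mul, ← Finset.mul_sum]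
    exact mul_le_mul_of_nonneg_left hsum ht.le

/-! ### The 28 linear forms (26), the index set `F` (27), and `δ₂₈` -/

/-- The 28 linear forms `h₁,…,h₂₈` of (26), entry `k` = `h_{k+1}` (K `h_explicit`; `BrownZudilin2022.hList`). -/
def h28 (a : Dir) : Fin 28 → ℝ :=
  ![a 0, a 1, a 2, a 3, a 4, a 5, a 6, a 7,
    a 0 + a 1 - a 3, a 0 + a 4 - a 2, a 0 + a 7 - a 2,
    a 1 + a 2 - a 4, a 1 + a 2 - a 7, a 2 + a 5 - a 7,
    a 2 + a 3 - a 0, a 3 + a 4 - a 1, a 3 + a 7 - a 5,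
    a 3 + a 7 - a 1, a 4 + a 5 - a 7, a 6 + a 7 - a 5,
    a 0 + a 1 + a 5 - a 3 - a 7, a 0 + a 6 + a 7 - a 2 - a 5,
    a 1 + a 2 + a 5 - a 3 - a 7, a 1 + a 2 + a 5 - a 6 - a 7,
    a 3 + a 4 + a 7 - a 1 - a 2, a 3 + a 6 + a 7 - a 1 - a 5,
    a 3 + a 6 + 2 * a 7 - a 1 - a 2 - a 5, a 3 + a 4 + a 6 + a 7 - a 1 - a 2 - a 5]

/-- The forms are linear: `h(t·a) = t·h(a)`. -/
theorem h28_smul (t : ℝ) (a : Dir) : h28 (t • a) = t • h28 a := by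
  ext k; fin_cases k <;> simp [h28, smul_eq_mul] <;> ring

/-- Agreement with the Literature list (26) on integer vectors: `h28 (realDir a) k = h_{k+1}(a)`. -/
theorem h28_realDir (a : Fin 8 → ℤ) (k : Fin 28) : h28 (realDir a) k = (hForm a (k + 1) : ℝ) := by
  fin_cases k <;> simp [h28, hForm, hList, realDir]

/-- The index set `F = {1,2,3,4,5,6,7,9,10,11,14,16,18,20,23,27,28}` of (27), 0-based. -/
def FIdx : Finset (Fin 28) := {0, 1, 2, 3, 4, 5, 6, 8, 9, 10, 13, 15, 17, 19, 22, 26, 27}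

/-- `Σ_{i∈F} h_i(a) = 2s₀ + 4(s₁+⋯+s₇)` — an `S₇`-INVARIANT linear form; this identity is what makes `N_a`
1-periodic and K's `∫₀¹ N_a ψ′` equal to `∫₀^∞ N_a u⁻²` (BARRIER-FORMULAS §4). -/
theorem sum_FIdx_h28 (a : Dir) :
    ∑ i ∈ FIdx, h28 a i = 2 * sParam a 0 + 4 * ∑ j : Fin 7, sParam a j.succ := by
  simp [FIdx, h28, sParam, Fin.sum_univ_succ]
  ring

/-- There are 5-element subsets of `Fin 28`. -/
theorem fiveSubsets_nonempty : ((Finset.univ : Finset (Fin 28)).powersetCard 5).Nonempty := by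
  rw [Finset.powersetCard_nonempty]; simp

/-- **`δ₂₈(a) = m₁ + ⋯ + m₅`**, the exponent of BZ's lcm-denominator (28), as the MAXIMUM over 5-element index sets
`S` of `Σ_{i∈S} h_i(a)` (= the sum of the five largest of the 28 forms; K `five_maxima`/`sum_m`). Continuous,
convex, piecewise linear. -/
def delta28 (a : Dir) : ℝ :=
  ((Finset.univ : Finset (Fin 28)).powersetCard 5).sup' fiveSubsets_nonempty fun S => ∑ i ∈ S, h28 a i

/-- `δ₂₈` is degree-1 homogeneous for every real `t ≥ 0`. -/
theorem delta28_smul {t : ℝ} (ht : 0 ≤ t) (a : Dir) : delta28 (t • a) = t * delta28 a := by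
  unfold delta28
  apply le_antisymm
  · refine Finset.sup'_le _ _ fun S hS => ?_
    have hle : ∑ i ∈ S, h28 a i ≤
        ((Finset.univ : Finset (Fin 28)).powersetCard 5).sup' fiveSubsets_nonempty
          (fun S => ∑ i ∈ S, h28 a i) :=
      Finset.le_sup' (fun S => ∑ i ∈ S, h28 a i) hS
    calc ∑ i ∈ S, h28 (t • a) i = t * ∑ i ∈ S, h28 a i := by
          simp [h28_smul, Finset.mul_sum]
      _ ≤ _ := mul_le_mul_of_nonneg_left hle ht
  · obtain ⟨S, hS, hmax⟩ := Finset.exists_mem_eq_sup' fiveSubsets_nonempty fun S => ∑ i ∈ S, h28 a i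
    rw [hmax]
    have : t * ∑ i ∈ S, h28 a i = ∑ i ∈ S, h28 (t • a) i := by simp [h28_smul, Finset.mul_sum]
    rw [this]
    exact Finset.le_sup' (fun S => ∑ i ∈ S, h28 (t • a) i) hS

/-- A threshold CERTIFICATE for upper bounds on `δ₂₈` without enumerating the 98 280 subsets: for any `τ`,
`δ₂₈(a) ≤ 5τ + Σ_{i<28} max(h_i(a) − τ, 0)` (LP duality for «sum of the 5 largest»; equality at `τ = m₅`). -/
theorem delta28_le_threshold (a : Dir) (τ : ℝ) :
    delta28 a ≤ 5 * τ + ∑ i : Fin 28, max (h28 a i - τ) 0 := by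
  unfold delta28
  refine Finset.sup'_le _ _ fun S hS => ?_
  have hcard : S.card = 5 := (Finset.mem_powersetCard.mp hS).2
  calc ∑ i ∈ S, h28 a i ≤ ∑ i ∈ S, (τ + max (h28 a i - τ) 0) := by
        refine Finset.sum_le_sum fun i _ => ?_
        have := le_max_left (h28 a i - τ) 0
        linarith
    _ = 5 * τ + ∑ i ∈ S, max (h28 a i - τ) 0 := by
        rw [Finset.sum_add_distrib, Finset.sum_const, hcard]; simp
    _ ≤ 5 * τ + ∑ i : Fin 28, max (h28 a i - τ) 0 := by
        have := Finset.sum_le_univ_sum_of_nonneg (s := S) (f := fun i => max (h28 a i - τ) 0)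
          fun i => le_max_right _ _
        linarith

/-- Lower bounds on `δ₂₈` from a single 5-set. -/
theorem le_delta28 (a : Dir) {S : Finset (Fin 28)} (hS : S.card = 5) : ∑ i ∈ S, h28 a i ≤ delta28 a := by
  unfold delta28
  exact Finset.le_sup' (fun S => ∑ i ∈ S, h28 a i) (Finset.mem_powersetCard.mpr ⟨Finset.subset_univ _, hS⟩)

/-! ### The `S₇` saving (29)–(30): `N_a(u)` and `Φ(a)` -/

/-- `σ ∈ S₇` acting on symmetric parameters: fixes `s₀`, permutes `s₁..s₇`. -/
def permS (σ : Equiv.Perm (Fin 7)) (s : Fin 8 → ℝ) : Fin 8 → ℝ :=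
  Fin.cons (s 0) fun j => s (σ j).succ

/-- `σ ∈ S₇ ≅ G` acting on directions (BZ §10: `G` acts on `a` via `S₇` permuting `s₁..s₇`). -/
def permAct (σ : Equiv.Perm (Fin 7)) (a : Dir) : Dir := aOfS (permS σ (sParam a))

/-- The action is linear. -/
theorem permAct_smul (σ : Equiv.Perm (Fin 7)) (t : ℝ) (a : Dir) : permAct σ (t • a) = t • permAct σ a := by
  unfold permAct
  rw [sParam_smul, ← aOfS_smul]
  congr 1
  ext j
  refine Fin.cases ?_ (fun i => ?_) j <;> simp [permS]

/-- `σ` is ADMISSIBLE at `a` when `σ·a` is again convergent: `h_i(σa) ≥ 0` for all `i ∈ F` (K l.285–290: only such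
`σ` give a legitimate relation `I′(a·n) ↔ I′(σa·n)`; on the positive box every `σ` is admissible). -/
def Admissible (a : Dir) (σ : Equiv.Perm (Fin 7)) : Prop := ∀ i ∈ FIdx, 0 ≤ h28 (permAct σ a) i

/-- Admissibility is dilation invariant. -/
theorem admissible_smul {t : ℝ} (ht : 0 < t) (a : Dir) (σ : Equiv.Perm (Fin 7)) :
    Admissible (t • a) σ ↔ Admissible a σ := by
  simp only [Admissible, permAct_smul, h28_smul, Pi.smul_apply, smul_eq_mul]
  constructor
  · intro h i hi
    have := h i hi
    rcases (mul_nonneg_iff_of_pos_left ht).mp this with h'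
    exact h'
  · intro h i hi
    exact mul_nonneg ht.le (h i hi)


/-- The 28 forms in symmetric parameters: `h′ = {s_i + s_j}` (21 forms), `h″ = {s₀ − s_j}` (7 forms) (BZ §10 p. 26;
K `PAIR_OF_H` l.48–50), listed in the order of (26). -/
theorem h28_aOfS (s : Fin 8 → ℝ) :
    h28 (aOfS s) = ![s 1 + s 2, s 0 - s 2, s 2 + s 3, s 0 - s 3, s 3 + s 4, s 5 + s 6, s 6 + s 7, s 3 + s 5,
      s 1 + s 3, s 1 + s 4, s 1 + s 5, s 0 - s 4, s 0 - s 5, s 2 + s 6, s 0 - s 1, s 2 + s 4, s 0 - s 6,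
      s 2 + s 5, s 4 + s 6, s 3 + s 7, s 1 + s 6, s 1 + s 7, s 3 + s 6, s 0 - s 7, s 4 + s 5, s 2 + s 7,
      s 5 + s 7, s 4 + s 7] := by
  ext k; fin_cases k <;> simp [h28, aOfS] <;> ring

/-- **On the closed box all 28 forms are non-negative** (so `P̄ ⊆ D₁` and no admissibility is lost there). -/
theorem h28_nonneg_of_BZBox {a : Dir} (h : BZBox a) (k : Fin 28) : 0 ≤ h28 a k := by
  obtain ⟨h0, hj⟩ := h
  obtain ⟨h1a, h1b⟩ := hj 0
  obtain ⟨h2a, h2b⟩ := hj 1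
  obtain ⟨h3a, h3b⟩ := hj 2
  obtain ⟨h4a, h4b⟩ := hj 3
  obtain ⟨h5a, h5b⟩ := hj 4
  obtain ⟨h6a, h6b⟩ := hj 5
  obtain ⟨h7a, h7b⟩ := hj 6
  simp only [Fin.succ_zero_eq_one] at h1a h1b
  change 0 ≤ sParam a 2 at h2a; change sParam a 2 ≤ sParam a 0 at h2b
  change 0 ≤ sParam a 3 at h3a; change sParam a 3 ≤ sParam a 0 at h3b
  change 0 ≤ sParam a 4 at h4a; change sParam a 4 ≤ sParam a 0 at h4b
  change 0 ≤ sParam a 5 at h5a; change sParam a 5 ≤ sParam a 0 at h5b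
  change 0 ≤ sParam a 6 at h6a; change sParam a 6 ≤ sParam a 0 at h6b
  change 0 ≤ sParam a 7 at h7a; change sParam a 7 ≤ sParam a 0 at h7b
  rw [← aOfS_sParam a, h28_aOfS]
  fin_cases k <;> simp <;> linarith

/-- The box is `S₇`-invariant. -/
theorem BZBox_permAct {a : Dir} (h : BZBox a) (σ : Equiv.Perm (Fin 7)) : BZBox (permAct σ a) := by
  obtain ⟨h0, hj⟩ := h
  unfold permAct BZBox
  rw [sParam_aOfS]
  refine ⟨by simpa [permS] using h0, fun j => ?_⟩
  simpa [permS] using hj (σ j)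

/-- **On the closed box every `σ ∈ S₇` is admissible** (K: `n_inadmissible_g = 0` on `P`; hence the lane's
superset `G_B` of admissible permutations is all of `S₇` there, BARRIER-PLAN §2 ii.3). -/
theorem admissible_of_BZBox {a : Dir} (h : BZBox a) (σ : Equiv.Perm (Fin 7)) : Admissible a σ :=
  fun i _ => h28_nonneg_of_BZBox (BZBox_permAct h σ) i

open scoped Classical in
/-- The contribution of `σ` at `u = n/p`: `Σ_{i∈F} (⌊h_i(a)u⌋ − ⌊h_i(σa)u⌋)` if `σ` is admissible, else `0`
(for `p > √(m₁n)`, `ord_p (h_i n)! = ⌊h_i n/p⌋`, so this is `ord_p (∏_F h_i! / ∏_F (σh)_i!)` of (29)). -/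
def savingTerm (a : Dir) (u : ℝ) (σ : Equiv.Perm (Fin 7)) : ℤ :=
  if Admissible a σ then ∑ i ∈ FIdx, (⌊h28 a i * u⌋ - ⌊h28 (permAct σ a) i * u⌋) else 0

/-- **`N_a(u) = max_σ savingTerm`** — the exponent `ν_p` of (29) at `u = n/p` (K `group_saving`: `best = S_base −
min S_img ≥ 0`, the identity `σ` contributing `0`). -/
def savingN (a : Dir) (u : ℝ) : ℤ :=
  (Finset.univ : Finset (Equiv.Perm (Fin 7))).sup' Finset.univ_nonempty (savingTerm a u)

/-- The identity permutation acts trivially. -/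
theorem permS_one (s : Fin 8 → ℝ) : permS 1 s = s := by
  ext j
  refine Fin.cases ?_ (fun i => ?_) j
  · simp [permS]
  · simp [permS]

/-- The identity of `S₇` acts trivially on directions. -/
theorem permAct_one (a : Dir) : permAct 1 a = a := by
  simp [permAct, permS_one, aOfS_sParam]

open scoped Classical in
/-- `N_a(u) ≥ 0` (the identity permutation contributes `0`). -/
theorem savingN_nonneg (a : Dir) (u : ℝ) : 0 ≤ savingN a u := by
  unfold savingN
  have h1 : savingTerm a u 1 = 0 := by
    unfold savingTerm
    split_ifs
    · exact Finset.sum_eq_zero fun i _ => by simp [permAct_one]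
    · rfl
  rw [← h1]
  exact Finset.le_sup' (savingTerm a u) (Finset.mem_univ 1)

open scoped Classical in
/-- Dilation moves into the argument: `savingTerm (t·a) u σ = savingTerm a (t u) σ`. -/
theorem savingTerm_smul {t : ℝ} (ht : 0 < t) (a : Dir) (u : ℝ) (σ : Equiv.Perm (Fin 7)) :
    savingTerm (t • a) u σ = savingTerm a (t * u) σ := by
  unfold savingTerm
  by_cases h : Admissible a σ
  · rw [if_pos ((admissible_smul ht a σ).mpr h), if_pos h]
    refine Finset.sum_congr rfl fun i _ => ?_
    simp only [permAct_smul, h28_smul, Pi.smul_apply, smul_eq_mul]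
    rw [show t * h28 a i * u = h28 a i * (t * u) by ring,
      show t * h28 (permAct σ a) i * u = h28 (permAct σ a) i * (t * u) by ring]
  · rw [if_neg (fun h' => h ((admissible_smul ht a σ).mp h')), if_neg h]

/-- `N_{t·a}(u) = N_a(t u)`. -/
theorem savingN_smul {t : ℝ} (ht : 0 < t) (a : Dir) (u : ℝ) : savingN (t • a) u = savingN a (t * u) := by
  unfold savingN
  congr 1
  ext σ
  exact savingTerm_smul ht a u σ

/-- **`Φ(a) = ∫_{(0,∞)} N_a(u) u⁻² du`** — the `S₇` saving of (29)–(30) as a rate: `(1/n) log Φ_n(a) → Φ(a)`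
(PNT; BZ restrict to `p > √(m₁n)` so that Legendre's formula is the single term `⌊h_i n/p⌋`; the excluded primes
carry a vanishing share in the limit). K evaluates the equal quantity `∫₀¹ N_a(t) ψ′(t) dt` (1-periodicity of
`N_a`, `sum_FIdx_h28`); the `(0,∞)` form is taken as the DEFINITION because it is the primitive PNT limit and is
manifestly degree-1 homogeneous for every real `t > 0` (`phi30_smul`) — the continuum extension asked for in
BARRIER-FORMULAS §6 / BARRIER-PLAN N1. -/
def phi30 (a : Dir) : ℝ := ∫ u in Ioi (0 : ℝ), (savingN a u : ℝ) / u ^ 2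

/-- `Φ(t·a) = t·Φ(a)` for every real `t > 0` (substitution `u = w/t`; no integrability needed). -/
theorem phi30_smul {t : ℝ} (ht : 0 < t) (a : Dir) : phi30 (t • a) = t * phi30 a := by
  unfold phi30
  have hcomp := MeasureTheory.integral_comp_mul_left_Ioi
    (fun w : ℝ => t ^ 2 * ((savingN a w : ℝ) / w ^ 2)) 0 ht
  simp only [mul_zero] at hcomp
  have hpt : ∀ u : ℝ, (savingN (t • a) u : ℝ) / u ^ 2 = t ^ 2 * ((savingN a (t * u) : ℝ) / (t * u) ^ 2) := by
    intro u
    rw [savingN_smul ht]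
    rcases eq_or_ne u 0 with rfl | hu
    · simp
    · field_simp
  simp_rw [hpt]
  rw [hcomp, integral_const_mul, smul_eq_mul]
  field_simp

end Summit.KontsevichZagierPeriods.Zeta5Search.Barrier.ConeGamma

end
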